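import Summits.KontsevichZagierPeriods.Zeta5Search.Barrier.ConeGammaCuspPeriodGordan

/-!
# ζ(5) search — BARRIER: GORDAN'S ALTERNATIVE FOR THE CUSP SLOPE — Carathéodory's bound and the canonical form

HONEST FRAMING (cell `pub-zeta5`): systematic search; no irrationality claim unless kernel-certified. MODEL objects
under Brown–Zudilin's (28)+(30) accounting ([BZ22] = arXiv:2210.03391; (28) observed, not proved); nothing here is a
statement about `ζ(5)`, any `γ` of record, the cone's supremum (C2 OPEN) or the value / sign of the cusp slope, of a
chamber weight or of a certificate at a named direction (DATA of the cell); NO certificate instance is asserted for any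
named direction (at record/41, flag/60, argmax-120, t*/480 ascent directions exist — DATA); S-E stays CONJECTURED;
records in print UNMOVED. Prover P2 g34, item «GORDAN'S ALTERNATIVE FOR THE CUSP SLOPE», file (2) of 2 (theorems only).

* `hull_certificate_card_le_nine` / `hull_certificate_card_le_eight` — CARATHÉODORY: a hull certificate of a family of
  functionals on `ℝ⁸` linear in the 8 coordinates can always be shrunk to at most `9` references with POSITIVE weights
  (Mathlib's `eq_pos_convex_span_of_mem_convexHull` + `AffineIndependent.card_le_finrank_succ`), and to at most `8` when
  every certified functional kills one common non-zero displacement (the gradients then lie in a hyperplane);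
* **`hull_certificate_card_le_eight_period`** — for the chamber functionals of a period pattern function (any extension,
  any type) every hull certificate of generic references shrinks to AT MOST EIGHT of its references with positive weights:
  the chamber weights add up to zero (`period_greedy_sum_eq_zero`), so every chamber functional kills the radial
  displacement `s(a)`;
* **`hull_certificate_of_forall_cuspSlope_nonpos_canonical`** — THE NECESSARY CONDITION AT A CUSP TOP IN CANONICAL FORM:
  all 28 forms of `a` positive, `T > 0` a period, `F = Σ_m patternN a b_m` the canonical period pattern function (P2 g33);
  if `cuspSlope a T δ ≤ 0` for every `δ` then AT MOST EIGHT generic references `δ₀` with positive weights `t` have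
  `Σ t δ₀ · G_{δ₀} ≡ 0` — hypotheses hpos / hT / hper / hF only;
* `forall_cuspSlope_nonpos_iff_hull_certificate_of_supermodular_canonical` — Gordan's converse in canonical form
  (the supermodularity of the canonical `F` a HYPOTHESIS, data-false at the four named directions);
  `exists_greedy_nonpos_of_forall_cuspSlope_nonpos_canonical` — no uniform ascent displacement at a cusp top.
P2 g31's desk (L4, DATA): hull supports of size 8 at record/41, flag/60, argmax-120, t*/480 — the bound of this file,
observed; they certify nothing there (ascent directions exist). NOT here: any certificate at a named direction; `γ`, C2,
S-E, `ζ(5)`.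
-/

noncomputable section

open Set MeasureTheory Finset
open scoped Topology

namespace Summit.KontsevichZagierPeriods.Zeta5Search.Barrier.ConeGamma

/-! ### Carathéodory: a hull certificate needs at most `dim + 1` references -/

/-- **CARATHÉODORY FOR HULL CERTIFICATES.** `G δ₀` linear in the 8 coordinates; a hull certificate — references
`δ₀ ∈ s`, weights `t ≥ 0` with `Σ t > 0` and `Σ_{δ₀∈s} t δ₀ · G δ₀ ≡ 0` — whose gradients `(G δ₀ e_p)_p`, `δ₀ ∈ s`, lie
in a subspace `V` can be replaced by one supported on AT MOST `dim V + 1` of the same references, with POSITIVE weights: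
zero is in the convex hull of the gradients, hence (Mathlib's `eq_pos_convex_span_of_mem_convexHull`) a positive
combination of an affinely independent subfamily, which has at most `dim V + 1` members
(`AffineIndependent.card_le_finrank_succ`). -/
theorem hull_certificate_card_le_finrank_succ (G : (Fin 8 → ℝ) → (Fin 8 → ℝ) → ℝ)
    (hlin : ∀ δ₀ δ, G δ₀ δ = ∑ p, δ p * G δ₀ (Pi.single p (1 : ℝ)))
    (V : Submodule ℝ (Fin 8 → ℝ)) {s : Finset (Fin 8 → ℝ)}
    (hV : ∀ δ₀ ∈ s, (fun p : Fin 8 => G δ₀ (Pi.single p (1 : ℝ))) ∈ V)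
    {t : (Fin 8 → ℝ) → ℝ} (ht : ∀ δ₀ ∈ s, 0 ≤ t δ₀) (htpos : 0 < ∑ δ₀ ∈ s, t δ₀)
    (hzero : ∀ δ : Fin 8 → ℝ, ∑ δ₀ ∈ s, t δ₀ * G δ₀ δ = 0) :
    ∃ (s' : Finset (Fin 8 → ℝ)) (t' : (Fin 8 → ℝ) → ℝ), s' ⊆ s ∧ s'.card ≤ Module.finrank ℝ V + 1 ∧
      (∀ δ₀ ∈ s', 0 < t' δ₀) ∧ 0 < ∑ δ₀ ∈ s', t' δ₀ ∧ ∀ δ : Fin 8 → ℝ, ∑ δ₀ ∈ s', t' δ₀ * G δ₀ δ = 0 := by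
  classical
  -- gradients
  obtain ⟨v, hv⟩ : ∃ v : (Fin 8 → ℝ) → Fin 8 → ℝ, ∀ δ₀ p, v δ₀ p = G δ₀ (Pi.single p (1 : ℝ)) :=
    ⟨_, fun _ _ => rfl⟩
  have hG : ∀ δ₀ δ, G δ₀ δ = ∑ p, δ p * v δ₀ p := fun δ₀ δ => by simp only [hv]; exact hlin δ₀ δ
  have hvV : ∀ δ₀ ∈ s, v δ₀ ∈ V := fun δ₀ hδ₀ => by
    have e : v δ₀ = fun p => G δ₀ (Pi.single p (1 : ℝ)) := funext fun p => hv δ₀ p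
    rw [e]; exact hV δ₀ hδ₀
  -- zero is the centre of mass of the gradients of `s`
  have hcm : s.centerMass t v = 0 := by
    have hsum : ∑ δ₀ ∈ s, t δ₀ • v δ₀ = 0 := by
      funext p
      simp only [Finset.sum_apply, Pi.smul_apply, smul_eq_mul, Pi.zero_apply, hv]
      exact hzero _
    rw [Finset.centerMass, hsum, smul_zero]
  have h0 : (0 : Fin 8 → ℝ) ∈ convexHull ℝ (v '' ↑s) := by
    rw [← hcm]
    exact s.centerMass_mem_convexHull ht htpos fun δ₀ hδ₀ => ⟨δ₀, hδ₀, rfl⟩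
  -- Carathéodory: an affinely independent positive subfamily
  obtain ⟨ι, _, z, w, hzs, hzind, hwpos, hw1, hwz⟩ := eq_pos_convex_span_of_mem_convexHull h0
  have hcard : Fintype.card ι ≤ Module.finrank ℝ V + 1 := by
    have h1 := hzind.card_le_finrank_succ
    have h2 : vectorSpan ℝ (Set.range z) ≤ V := by
      rw [vectorSpan_def]
      refine Submodule.span_le.mpr ?_
      rintro _ ⟨x, hx, y, hy, rfl⟩
      obtain ⟨δ₁, hδ₁, rfl⟩ := hzs hx
      obtain ⟨δ₂, hδ₂, rfl⟩ := hzs hy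
      show v δ₁ -ᵥ v δ₂ ∈ V
      rw [vsub_eq_sub]
      exact V.sub_mem (hvV δ₁ hδ₁) (hvV δ₂ hδ₂)
    have h3 := Submodule.finrank_mono h2
    omega
  -- a reference of `s` behind every member of the subfamily
  have hback : ∀ i, ∃ δ₀ ∈ s, v δ₀ = z i := fun i => by
    obtain ⟨δ₀, hδ₀, h⟩ := hzs ⟨i, rfl⟩
    exact ⟨δ₀, hδ₀, h⟩
  choose ref hrefs hrefv using hback
  have hmaps : ∀ i ∈ (Finset.univ : Finset ι), ref i ∈ Finset.univ.image ref := fun i _ =>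
    Finset.mem_image_of_mem ref (Finset.mem_univ i)
  refine ⟨Finset.univ.image ref, fun δ₀ => ∑ i ∈ Finset.univ.filter (fun i => ref i = δ₀), w i,
    ?_, ?_, ?_, ?_, ?_⟩
  · intro δ₀ hδ₀
    obtain ⟨i, -, rfl⟩ := Finset.mem_image.mp hδ₀
    exact hrefs i
  · exact Finset.card_image_le.trans (by rwa [Finset.card_univ])
  · intro δ₀ hδ₀
    obtain ⟨i, -, rfl⟩ := Finset.mem_image.mp hδ₀
    exact Finset.sum_pos (fun j _ => hwpos j) ⟨i, Finset.mem_filter.mpr ⟨Finset.mem_univ _, rfl⟩⟩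
  · dsimp only
    rw [Finset.sum_fiberwise_of_maps_to hmaps w, hw1]
    exact one_pos
  · intro δ
    dsimp only
    have e : ∀ δ₀ ∈ Finset.univ.image ref, (∑ i ∈ Finset.univ.filter (fun i => ref i = δ₀), w i) * G δ₀ δ =
        ∑ i ∈ Finset.univ.filter (fun i => ref i = δ₀), w i * G (ref i) δ := fun δ₀ _ => by
      rw [Finset.sum_mul]
      exact Finset.sum_congr rfl fun i hi => by rw [(Finset.mem_filter.mp hi).2]
    rw [Finset.sum_congr rfl e, Finset.sum_fiberwise_of_maps_to hmaps (fun i => w i * G (ref i) δ)]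
    have hz : ∀ p, ∑ i, w i * z i p = 0 := fun p => by
      have := congrArg (fun x : Fin 8 → ℝ => x p) hwz
      simpa only [Finset.sum_apply, Pi.smul_apply, smul_eq_mul, Pi.zero_apply] using this
    calc ∑ i, w i * G (ref i) δ = ∑ i, w i * ∑ p, δ p * z i p :=
          Finset.sum_congr rfl fun i _ => by rw [hG, hrefv i]
      _ = ∑ p, δ p * ∑ i, w i * z i p := by
          simp_rw [Finset.mul_sum]
          rw [Finset.sum_comm]
          exact Finset.sum_congr rfl fun p _ => Finset.sum_congr rfl fun i _ => by ring
      _ = 0 := Finset.sum_eq_zero fun p _ => by rw [hz p, mul_zero]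

/-- **At most nine references** for any hull certificate of functionals on `ℝ⁸` linear in the coordinates (`V = ℝ⁸`). -/
theorem hull_certificate_card_le_nine (G : (Fin 8 → ℝ) → (Fin 8 → ℝ) → ℝ)
    (hlin : ∀ δ₀ δ, G δ₀ δ = ∑ p, δ p * G δ₀ (Pi.single p (1 : ℝ)))
    {s : Finset (Fin 8 → ℝ)} {t : (Fin 8 → ℝ) → ℝ} (ht : ∀ δ₀ ∈ s, 0 ≤ t δ₀) (htpos : 0 < ∑ δ₀ ∈ s, t δ₀)
    (hzero : ∀ δ : Fin 8 → ℝ, ∑ δ₀ ∈ s, t δ₀ * G δ₀ δ = 0) :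
    ∃ (s' : Finset (Fin 8 → ℝ)) (t' : (Fin 8 → ℝ) → ℝ), s' ⊆ s ∧ s'.card ≤ 9 ∧ (∀ δ₀ ∈ s', 0 < t' δ₀) ∧
      0 < ∑ δ₀ ∈ s', t' δ₀ ∧ ∀ δ : Fin 8 → ℝ, ∑ δ₀ ∈ s', t' δ₀ * G δ₀ δ = 0 := by
  obtain ⟨s', t', hs', hcard, h⟩ := hull_certificate_card_le_finrank_succ G hlin ⊤ (fun _ _ => Submodule.mem_top)
    ht htpos hzero
  refine ⟨s', t', hs', hcard.trans ?_, h⟩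
  rw [finrank_top, Module.finrank_fin_fun]

/-- **The hyperplane orthogonal to a non-zero `c ∈ ℝ⁸` has dimension at most `7`**: the functional `x ↦ Σ_p c_p x_p`
is a linear map with a non-trivial range, so its kernel has `finrank ≤ 8 − 1` (rank–nullity). -/
theorem exists_dotLinear_finrank_ker_le_seven {c : Fin 8 → ℝ} (hc : c ≠ 0) :
    ∃ ℓ : (Fin 8 → ℝ) →ₗ[ℝ] ℝ, (∀ x, ℓ x = ∑ p, c p * x p) ∧ Module.finrank ℝ (LinearMap.ker ℓ) ≤ 7 := by
  obtain ⟨ℓ, hℓ⟩ : ∃ ℓ : (Fin 8 → ℝ) →ₗ[ℝ] ℝ, ∀ x, ℓ x = ∑ p, c p * x p :=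
    ⟨{ toFun := fun x => ∑ p, c p * x p
       map_add' := fun x y => by
         simp only [Pi.add_apply, mul_add, Finset.sum_add_distrib]
       map_smul' := fun r x => by
         simp only [Pi.smul_apply, smul_eq_mul, RingHom.id_apply, Finset.mul_sum]
         exact Finset.sum_congr rfl fun _ _ => by ring }, fun _ => rfl⟩
  have hℓc : ℓ c ≠ 0 := by
    rw [hℓ]
    obtain ⟨p, hp⟩ : ∃ p, c p ≠ 0 := Function.ne_iff.mp hc
    exact (Finset.sum_pos' (fun q _ => mul_self_nonneg (c q)) ⟨p, Finset.mem_univ _, mul_self_pos.mpr hp⟩).ne'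
  refine ⟨ℓ, hℓ, ?_⟩
  have h1 := ℓ.finrank_range_add_finrank_ker
  rw [Module.finrank_fin_fun] at h1
  have h2 : Module.finrank ℝ (LinearMap.range ℓ) ≠ 0 := by
    rw [Ne, Submodule.finrank_eq_zero, LinearMap.range_eq_bot]
    intro h
    exact hℓc (by rw [h, LinearMap.zero_apply])
  omega

/-- **At most eight references** when every certified functional kills one common non-zero displacement `c`
(`G δ₀ c = 0` for `δ₀ ∈ s`): the gradients lie in the hyperplane `{x : Σ_p c_p x_p = 0}`, of dimension `7`. -/
theorem hull_certificate_card_le_eight (G : (Fin 8 → ℝ) → (Fin 8 → ℝ) → ℝ)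
    (hlin : ∀ δ₀ δ, G δ₀ δ = ∑ p, δ p * G δ₀ (Pi.single p (1 : ℝ)))
    {c : Fin 8 → ℝ} (hc : c ≠ 0) {s : Finset (Fin 8 → ℝ)} (horth : ∀ δ₀ ∈ s, G δ₀ c = 0)
    {t : (Fin 8 → ℝ) → ℝ} (ht : ∀ δ₀ ∈ s, 0 ≤ t δ₀) (htpos : 0 < ∑ δ₀ ∈ s, t δ₀)
    (hzero : ∀ δ : Fin 8 → ℝ, ∑ δ₀ ∈ s, t δ₀ * G δ₀ δ = 0) :
    ∃ (s' : Finset (Fin 8 → ℝ)) (t' : (Fin 8 → ℝ) → ℝ), s' ⊆ s ∧ s'.card ≤ 8 ∧ (∀ δ₀ ∈ s', 0 < t' δ₀) ∧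
      0 < ∑ δ₀ ∈ s', t' δ₀ ∧ ∀ δ : Fin 8 → ℝ, ∑ δ₀ ∈ s', t' δ₀ * G δ₀ δ = 0 := by
  obtain ⟨ℓ, hℓ, hker⟩ := exists_dotLinear_finrank_ker_le_seven hc
  obtain ⟨s', t', hs', hcard, h⟩ := hull_certificate_card_le_finrank_succ G hlin (LinearMap.ker ℓ)
    (fun δ₀ hδ₀ => by rw [LinearMap.mem_ker, hℓ, ← hlin]; exact horth δ₀ hδ₀) ht htpos hzero
  exact ⟨s', t', hs', by omega, h⟩

/-! ### The chamber functionals kill the radial displacement: at most EIGHT references -/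

/-- The 28 forms of the radial displacement `s(a)` are the `h_k(a)`; so its 28 rates are all `1`. -/
theorem phiForm_sParam (a : Dir) (k : Fin 28) : phiForm (sParam a) k = h28 a k := by
  have h := phiForm_smul_sParam 1 a k
  rwa [one_smul, one_mul] at h

/-- **EVERY HULL CERTIFICATE OF A PERIOD SHRINKS TO AT MOST EIGHT REFERENCES.** All 28 forms of `a` positive, `T > 0` a
period, `f m` / `M m` / `F` as in `cuspSlope_eq_lovasz_period` (any extension, any type). A hull certificate on generic
references `δ₀ ∈ s` (weights `t ≥ 0`, `Σ t > 0`, `Σ t δ₀ · G_{δ₀} ≡ 0`) can be replaced by one on at most `8` of the same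
references with positive weights: every chamber functional vanishes at the radial displacement `s(a)` (its 28 rates are
`1` and the chamber weights add up to `0`, `period_greedy_sum_eq_zero`), so the chamber gradients span at most a
hyperplane and Carathéodory's bound is `7 + 1`. -/
theorem hull_certificate_card_le_eight_period {a : Dir} (hpos : ∀ k, 0 < h28 a k) {T : ℝ} (hT : 0 < T)
    (hper : ∀ k : Fin 28, ∃ z : ℤ, T * h28 a k = z)
    {M : ℕ → Finset (Fin 28)} {f : ℕ → Finset (Fin 28) → ℝ}
    (hf : ∀ m, m + 1 < (bkpts a T).card → ∀ Δ : Fin 8 → ℝ, (∀ k, |phiForm Δ k| < 1) →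
      (∀ k, |phiForm Δ k| < wallDist a T) →
        (torusN (bkpt a T m • sParam a + Δ) : ℝ) = f m ((M m).filter fun k => 0 ≤ phiForm Δ k))
    {F : Finset (Fin 28) → ℝ} (hF : ∀ A, F A = ∑ m ∈ Finset.range ((bkpts a T).card - 1), f m (A ∩ M m))
    {s : Finset (Fin 8 → ℝ)} {t : (Fin 8 → ℝ) → ℝ}
    (hgen : ∀ δ₀ ∈ s, ∀ k l : Fin 28, k ≠ l → phiForm δ₀ k / h28 a k ≠ phiForm δ₀ l / h28 a l)
    (ht : ∀ δ₀ ∈ s, 0 ≤ t δ₀) (htpos : 0 < ∑ δ₀ ∈ s, t δ₀)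
    (hzero : ∀ δ : Fin 8 → ℝ, ∑ δ₀ ∈ s, t δ₀ *
      ∑ k, (F (Finset.univ.filter fun l => phiForm δ₀ k / h28 a k ≤ phiForm δ₀ l / h28 a l) -
          F (Finset.univ.filter fun l => phiForm δ₀ k / h28 a k < phiForm δ₀ l / h28 a l)) *
        (phiForm δ k / h28 a k) = 0) :
    ∃ (s' : Finset (Fin 8 → ℝ)) (t' : (Fin 8 → ℝ) → ℝ), s' ⊆ s ∧ s'.card ≤ 8 ∧ (∀ δ₀ ∈ s', 0 < t' δ₀) ∧
      0 < ∑ δ₀ ∈ s', t' δ₀ ∧ ∀ δ : Fin 8 → ℝ, ∑ δ₀ ∈ s', t' δ₀ *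
        ∑ k, (F (Finset.univ.filter fun l => phiForm δ₀ k / h28 a k ≤ phiForm δ₀ l / h28 a l) -
            F (Finset.univ.filter fun l => phiForm δ₀ k / h28 a k < phiForm δ₀ l / h28 a l)) *
          (phiForm δ k / h28 a k) = 0 := by
  have hc : sParam a ≠ 0 := fun h => by
    have h0 := phiForm_sParam a 0
    rw [h, ← zero_smul ℝ (sParam a), phiForm_smul, zero_mul] at h0
    exact (hpos 0).ne' h0.symm
  refine hull_certificate_card_le_eight
    (fun δ₀ δ => ∑ k, (F (Finset.univ.filter fun l => phiForm δ₀ k / h28 a k ≤ phiForm δ₀ l / h28 a l) -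
        F (Finset.univ.filter fun l => phiForm δ₀ k / h28 a k < phiForm δ₀ l / h28 a l)) * (phiForm δ k / h28 a k))
    (fun _ δ => sum_mul_rate_eq_sum_coord a _ δ) hc (fun δ₀ hδ₀ => ?_) ht htpos hzero
  -- every chamber functional kills `s(a)`: rates `1`, weights summing to `0`
  show ∑ k, (F (Finset.univ.filter fun l => phiForm δ₀ k / h28 a k ≤ phiForm δ₀ l / h28 a l) -
      F (Finset.univ.filter fun l => phiForm δ₀ k / h28 a k < phiForm δ₀ l / h28 a l)) *
    (phiForm (sParam a) k / h28 a k) = 0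
  rw [← period_greedy_sum_eq_zero hpos hT hper hf hF (hgen δ₀ hδ₀)]
  exact Finset.sum_congr rfl fun k _ => by rw [phiForm_sParam, div_self (hpos k).ne', mul_one]

/-- **AT A CUSP TOP: AT MOST EIGHT REFERENCES WITH POSITIVE WEIGHTS** (any extension, any type). With the data of
`cuspSlope_eq_lovasz_period`: if `cuspSlope a T δ ≤ 0` for every `δ`, there are at most `8` generic references `δ₀ ∈ s` and
positive weights `t` with `Σ_{δ₀∈s} t δ₀ · G_{δ₀}(δ) = 0` for every `δ`. -/
theorem exists_small_hull_certificate_of_forall_cuspSlope_nonpos {a : Dir} (hpos : ∀ k, 0 < h28 a k) {T : ℝ}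
    (hT : 0 < T) (hper : ∀ k : Fin 28, ∃ z : ℤ, T * h28 a k = z)
    {M : ℕ → Finset (Fin 28)} {f : ℕ → Finset (Fin 28) → ℝ}
    (hf : ∀ m, m + 1 < (bkpts a T).card → ∀ Δ : Fin 8 → ℝ, (∀ k, |phiForm Δ k| < 1) →
      (∀ k, |phiForm Δ k| < wallDist a T) →
        (torusN (bkpt a T m • sParam a + Δ) : ℝ) = f m ((M m).filter fun k => 0 ≤ phiForm Δ k))
    {F : Finset (Fin 28) → ℝ} (hF : ∀ A, F A = ∑ m ∈ Finset.range ((bkpts a T).card - 1), f m (A ∩ M m))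
    (hnonpos : ∀ δ, cuspSlope a T δ ≤ 0) :
    ∃ (s : Finset (Fin 8 → ℝ)) (t : (Fin 8 → ℝ) → ℝ), s.card ≤ 8 ∧
      (∀ δ₀ ∈ s, ∀ k l : Fin 28, k ≠ l → phiForm δ₀ k / h28 a k ≠ phiForm δ₀ l / h28 a l) ∧
        (∀ δ₀ ∈ s, 0 < t δ₀) ∧ 0 < ∑ δ₀ ∈ s, t δ₀ ∧
          ∀ δ : Fin 8 → ℝ, ∑ δ₀ ∈ s, t δ₀ *
            ∑ k, (F (Finset.univ.filter fun l => phiForm δ₀ k / h28 a k ≤ phiForm δ₀ l / h28 a l) -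
                F (Finset.univ.filter fun l => phiForm δ₀ k / h28 a k < phiForm δ₀ l / h28 a l)) *
              (phiForm δ k / h28 a k) = 0 := by
  obtain ⟨s, t, hgen, ht, htpos, hzero⟩ := hull_certificate_of_forall_cuspSlope_nonpos hpos hT hper hf hF hnonpos
  obtain ⟨s', t', hs', hcard, hpos', htpos', hzero'⟩ :=
    hull_certificate_card_le_eight_period hpos hT hper hf hF hgen ht htpos hzero
  exact ⟨s', t', hcard, fun δ₀ hδ₀ => hgen δ₀ (hs' hδ₀), hpos', htpos', hzero'⟩

/-! ### The canonical form: the saving's own period pattern function -/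

/-- **THE HULL CONDITION AT A CUSP TOP — CANONICAL FORM, NO STRUCTURAL HYPOTHESIS.** All 28 forms of `a` positive,
`T > 0` a period, `F(A) = Σ_{m<#bkpts−1} patternN a b_m A` the canonical period pattern function (P2 g33). If
`cuspSlope a T δ ≤ 0` for EVERY displacement `δ`, then there are AT MOST EIGHT generic references `δ₀ ∈ s` and positive
weights `t` with `Σ_{δ₀∈s} t δ₀ · Σ_k W_k(δ₀)·φ_k(δ)/h_k(a) = 0` for every `δ` — zero in the convex hull of at most eight
chamber gradients, each an explicit vector of the cell's own objects. Necessary, not sufficient (the canonical `F` is of no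
pure type at the four named directions — DATA); no instance asserted. -/
theorem hull_certificate_of_forall_cuspSlope_nonpos_canonical {a : Dir} (hpos : ∀ k, 0 < h28 a k) {T : ℝ}
    (hT : 0 < T) (hper : ∀ k : Fin 28, ∃ z : ℤ, T * h28 a k = z) {F : Finset (Fin 28) → ℝ}
    (hF : ∀ A, F A = ∑ m ∈ Finset.range ((bkpts a T).card - 1), ((patternN a (bkpt a T m) A : ℤ) : ℝ))
    (hnonpos : ∀ δ, cuspSlope a T δ ≤ 0) :
    ∃ (s : Finset (Fin 8 → ℝ)) (t : (Fin 8 → ℝ) → ℝ), s.card ≤ 8 ∧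
      (∀ δ₀ ∈ s, ∀ k l : Fin 28, k ≠ l → phiForm δ₀ k / h28 a k ≠ phiForm δ₀ l / h28 a l) ∧
        (∀ δ₀ ∈ s, 0 < t δ₀) ∧ 0 < ∑ δ₀ ∈ s, t δ₀ ∧
          ∀ δ : Fin 8 → ℝ, ∑ δ₀ ∈ s, t δ₀ *
            ∑ k, (F (Finset.univ.filter fun l => phiForm δ₀ k / h28 a k ≤ phiForm δ₀ l / h28 a l) -
                F (Finset.univ.filter fun l => phiForm δ₀ k / h28 a k < phiForm δ₀ l / h28 a l)) *
              (phiForm δ k / h28 a k) = 0 := by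
  classical
  exact exists_small_hull_certificate_of_forall_cuspSlope_nonpos hpos hT hper
    (M := fun m => Finset.univ.filter fun k => ∃ z : ℤ, bkpt a T m * h28 a k = z)
    (f := fun m A => ((patternN a (bkpt a T m) A : ℤ) : ℝ)) (canonical_junction_agreement a T)
    (canonical_period_eq_sum_inter hF) hnonpos

/-- **NO UNIFORM ASCENT DISPLACEMENT AT A CUSP TOP — CANONICAL FORM**: if `cuspSlope a T δ ≤ 0` for every `δ`, then at
every displacement SOME generic reference's canonical chamber functional is `≤ 0`. -/
theorem exists_greedy_nonpos_of_forall_cuspSlope_nonpos_canonical {a : Dir} (hpos : ∀ k, 0 < h28 a k) {T : ℝ}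
    (hT : 0 < T) (hper : ∀ k : Fin 28, ∃ z : ℤ, T * h28 a k = z) {F : Finset (Fin 28) → ℝ}
    (hF : ∀ A, F A = ∑ m ∈ Finset.range ((bkpts a T).card - 1), ((patternN a (bkpt a T m) A : ℤ) : ℝ))
    (hnonpos : ∀ δ, cuspSlope a T δ ≤ 0) (δ : Fin 8 → ℝ) :
    ∃ δ₀ : Fin 8 → ℝ, (∀ k l : Fin 28, k ≠ l → phiForm δ₀ k / h28 a k ≠ phiForm δ₀ l / h28 a l) ∧
      ∑ k, (F (Finset.univ.filter fun l => phiForm δ₀ k / h28 a k ≤ phiForm δ₀ l / h28 a l) -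
          F (Finset.univ.filter fun l => phiForm δ₀ k / h28 a k < phiForm δ₀ l / h28 a l)) *
        (phiForm δ k / h28 a k) ≤ 0 := by
  classical
  exact exists_greedy_nonpos_of_forall_cuspSlope_nonpos hpos hT hper
    (M := fun m => Finset.univ.filter fun k => ∃ z : ℤ, bkpt a T m * h28 a k = z)
    (f := fun m A => ((patternN a (bkpt a T m) A : ℤ) : ℝ)) (canonical_junction_agreement a T)
    (canonical_period_eq_sum_inter hF) hnonpos δ

/-- **GORDAN'S CONVERSE — CANONICAL FORM.** With the canonical period pattern function `F` supermodular (a HYPOTHESIS,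
data-false at the four named directions): `cuspSlope a T δ ≤ 0` for every `δ` IFF at most eight generic references with
positive weights have `Σ t δ₀ · G_{δ₀} ≡ 0`. -/
theorem forall_cuspSlope_nonpos_iff_hull_certificate_of_supermodular_canonical {a : Dir} (hpos : ∀ k, 0 < h28 a k)
    {T : ℝ} (hT : 0 < T) (hper : ∀ k : Fin 28, ∃ z : ℤ, T * h28 a k = z) {F : Finset (Fin 28) → ℝ}
    (hF : ∀ A, F A = ∑ m ∈ Finset.range ((bkpts a T).card - 1), ((patternN a (bkpt a T m) A : ℤ) : ℝ))
    (hsuper : ∀ A B : Finset (Fin 28), F A + F B ≤ F (A ∪ B) + F (A ∩ B)) :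
    (∀ δ, cuspSlope a T δ ≤ 0) ↔
      ∃ (s : Finset (Fin 8 → ℝ)) (t : (Fin 8 → ℝ) → ℝ), s.card ≤ 8 ∧
        (∀ δ₀ ∈ s, ∀ k l : Fin 28, k ≠ l → phiForm δ₀ k / h28 a k ≠ phiForm δ₀ l / h28 a l) ∧
          (∀ δ₀ ∈ s, 0 < t δ₀) ∧ 0 < ∑ δ₀ ∈ s, t δ₀ ∧
            ∀ δ : Fin 8 → ℝ, ∑ δ₀ ∈ s, t δ₀ *
              ∑ k, (F (Finset.univ.filter fun l => phiForm δ₀ k / h28 a k ≤ phiForm δ₀ l / h28 a l) -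
                  F (Finset.univ.filter fun l => phiForm δ₀ k / h28 a k < phiForm δ₀ l / h28 a l)) *
                (phiForm δ k / h28 a k) = 0 := by
  classical
  refine ⟨hull_certificate_of_forall_cuspSlope_nonpos_canonical hpos hT hper hF, ?_⟩
  rintro ⟨s, t, -, hgen, ht, htpos, hzero⟩ δ
  exact cuspSlope_nonpos_of_hull_certificate hpos hT hper
    (M := fun m => Finset.univ.filter fun k => ∃ z : ℤ, bkpt a T m * h28 a k = z)
    (f := fun m A => ((patternN a (bkpt a T m) A : ℤ) : ℝ)) (canonical_junction_agreement a T)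
    (canonical_period_eq_sum_inter hF) hsuper s (fun δ₀ => δ₀) hgen t (fun δ₀ hδ₀ => (ht δ₀ hδ₀).le) htpos hzero δ

end Summit.KontsevichZagierPeriods.Zeta5Search.Barrier.ConeGamma

end
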